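import Mathlib
import HarnessLib
import Literature.MathematicalPhysics.QuantumFieldTheory.YangMillsOS
import Literature.MathematicalPhysics.QuantumLattice.LatticeGaugeDLR

/-!
# Sketch — crux idea `peel-and-disseminate` for `WeakCouplingHypercubicLimit`
(crux item stmt-QuantumFields-16154, crux dir `Cruxes/HypercubicLimit`; ideator 1, round 1)

First lemmas of the line, typed over existing declarations (objects copied VERBATIM from the
registered skeleton `Cruxes/HypercubicLimit/Lines/conditional_mean_telescoping.lean`, which is not
importable):

* §1 `PeelingStep` — the abstract engine (one conditional-domination step), PROVED below
  (`peelingStep`), and `PeelingBound` — its `n`-fold iterate (statement).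
* §2 objects: `cubeEdges`, `cubeEdgesT`, `exterior`, `shellEdgesT`, `torusPlaquette`, `influence`.
* §3 `ConditionalInfluenceDomination` (CM) — the conditional FIRST moment of the cube-exterior
  influence, given the Markov blanket of a λ-times larger cube, is dominated by its `L²` norm times
  `C₀ + C₁ W`, `W ≥ 0` a bounded shell functional (the classical background energy induced by the
  outer boundary data); `BackgroundProductBound` (F) — products of `C₀ + C₁ W` over separated cubes
  cost `C₂ⁿ` (intended proof: odd-torus chessboard estimate + one-block pressure of `W`);
  `PeeledGaussianDomination` — the output: separated `n`-point functions of centred plaquettes are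
  at most `(C₂ · I₂(R))ⁿ` — NO `n^γ`, NO `Lⁿ` influence norms, NO hypercontractivity.
* §4 the glue `peeledGaussianDomination_of` is recorded as a `Prop`-level implication statement
  (`GlueShape`); its proof is (T) telescoping (landed, p76246) + `PeelingBound` + (CM) + (F).
-/

noncomputable section

open scoped ENNReal
open MeasureTheory Filter Topology
open Literature.MathematicalPhysics.QuantumLattice Literature.MathematicalPhysics.QuantumFieldTheory

namespace Summit.QuantumFields.YangMills.Cruxes.HypercubicLimit.PeelAndDisseminate

local notation "Zd4" => Literature.Probability.LatticeModels.Site 4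
local notation "ZdEdge4" => Literature.MathematicalPhysics.QuantumLattice.ZdEdge 4

/-! ## §1 The abstract peeling engine -/

/-- **One peeling step.** On a probability space with a sub-σ-algebra `m ≤ m₀`: if the
conditional mean of `|Z|` given `m` is a.e. dominated by `a · (C₀ + W)` with `W ≥ 0`, then for
every non-negative, bounded, `m`-measurable weight `Y` one has `∫ Y |Z| ≤ a ∫ Y (C₀ + W)`.
(Tower property + pull-out + monotonicity; this is what lets ride-along factors of the OTHER cubes
pass through the conditioning on one cube's exterior.) -/
def PeelingStep : Prop :=
  ∀ (Ω : Type) (m m₀ : MeasurableSpace Ω) (μ : Measure Ω) [IsProbabilityMeasure μ]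
    (_hm : m ≤ m₀) (Z W Y : Ω → ℝ) (a C₀ : ℝ),
    (∀ ω, 0 ≤ Y ω) → StronglyMeasurable[m] Y → (∃ B : ℝ, ∀ ω, |Y ω| ≤ B) →
    Integrable Z μ → Integrable W μ →
    (μ[(fun ω => |Z ω|) | m] ≤ᵐ[μ] fun ω => a * (C₀ + W ω)) →
      ∫ ω, Y ω * |Z ω| ∂μ ≤ a * ∫ ω, Y ω * (C₀ + W ω) ∂μ

/-- `PeelingStep` holds (provable now; Mathlib `integral_condExp`,
`condExp_mul_of_stronglyMeasurable_left`, `integral_mono_ae`). -/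
theorem peelingStep : PeelingStep := by
  intro Ω m m₀ μ _ hm Z W Y a C₀ hY0 hYm hYb hZ hW hdom
  obtain ⟨B, hB⟩ := hYb
  haveI : IsFiniteMeasure (μ.trim hm) := isFiniteMeasure_trim hm
  -- integrability facts
  have hYae : AEStronglyMeasurable Y μ := (hYm.mono hm).aestronglyMeasurable
  have habsZ : Integrable (fun ω => |Z ω|) μ := hZ.abs
  have hYZ : Integrable (fun ω => Y ω * |Z ω|) μ :=
    habsZ.bdd_mul hYae (ae_of_all _ fun ω => by
      rw [Real.norm_eq_abs]; exact hB ω)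
  have hrhs : Integrable (fun ω => a * (C₀ + W ω)) μ :=
    ((integrable_const C₀).add hW).const_mul a
  have hYrhs : Integrable (fun ω => Y ω * (a * (C₀ + W ω))) μ :=
    hrhs.bdd_mul hYae (ae_of_all _ fun ω => by
      rw [Real.norm_eq_abs]; exact hB ω)
  have hYcond : Integrable (fun ω => Y ω * (μ[(fun ω => |Z ω|) | m]) ω) μ :=
    integrable_condExp.bdd_mul hYae (ae_of_all _ fun ω => by
      rw [Real.norm_eq_abs]; exact hB ω)
  -- tower + pull-out: ∫ Y |Z| = ∫ μ[Y |Z| ‖ m] = ∫ Y · μ[|Z| ‖ m]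
  have hpull : μ[(fun ω => Y ω * |Z ω|) | m] =ᵐ[μ] fun ω => Y ω * (μ[(fun ω => |Z ω|) | m]) ω :=
    condExp_mul_of_stronglyMeasurable_left hYm hYZ habsZ
  have h1 : ∫ ω, Y ω * |Z ω| ∂μ = ∫ ω, Y ω * (μ[(fun ω => |Z ω|) | m]) ω ∂μ := by
    rw [← integral_condExp hm (f := fun ω => Y ω * |Z ω|)]
    exact integral_congr_ae hpull
  -- monotonicity against the a.e. domination, weighted by Y ≥ 0
  have h2 : ∫ ω, Y ω * (μ[(fun ω => |Z ω|) | m]) ω ∂μ ≤ ∫ ω, Y ω * (a * (C₀ + W ω)) ∂μ := by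
    refine integral_mono_ae hYcond hYrhs ?_
    filter_upwards [hdom] with ω hω
    exact mul_le_mul_of_nonneg_left hω (hY0 ω)
  calc ∫ ω, Y ω * |Z ω| ∂μ
      = ∫ ω, Y ω * (μ[(fun ω => |Z ω|) | m]) ω ∂μ := h1
    _ ≤ ∫ ω, Y ω * (a * (C₀ + W ω)) ∂μ := h2
    _ = a * ∫ ω, Y ω * (C₀ + W ω) ∂μ := by
        rw [← integral_const_mul]
        refine integral_congr_ae (ae_of_all _ fun ω => ?_)
        ring

/-- **`n`-fold peeling** (statement; induction on the number of cubes using `PeelingStep`):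
given sub-σ-algebras `m k` (the exteriors of the λ-cubes), integrands `Z k` (the influences) and
shell functionals `W k ≥ 0` such that every `Z l`, `W l` with `l ≠ k` and `W k` itself are
`m k`-measurable, the a.e. dominations `μ[|Z k| ‖ m k] ≤ a (C₀ + W k)` give
`∫ ∏ |Z k| ≤ aⁿ ∫ ∏ (C₀ + W k)` — only POSITIVE ride-along factors survive. -/
def PeelingBound : Prop :=
  ∀ (Ω : Type) (m₀ : MeasurableSpace Ω) (μ : Measure Ω) [IsProbabilityMeasure μ] (n : ℕ)
    (m : Fin n → MeasurableSpace Ω) (_hm : ∀ k, m k ≤ m₀) (Z W : Fin n → Ω → ℝ) (a C₀ : ℝ),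
    0 ≤ a → 0 ≤ C₀ → (∀ k ω, 0 ≤ W k ω) → (∃ B : ℝ, ∀ k ω, |Z k ω| ≤ B ∧ W k ω ≤ B) →
    (∀ k, Measurable (Z k)) → (∀ k, Measurable (W k)) →
    (∀ k l, l ≠ k → StronglyMeasurable[m k] (Z l) ∧ StronglyMeasurable[m k] (W l)) →
    (∀ k, StronglyMeasurable[m k] (W k)) →
    (∀ k, μ[(fun ω => |Z k ω|) | m k] ≤ᵐ[μ] fun ω => a * (C₀ + W k ω)) →
      ∫ ω, ∏ k, |Z k ω| ∂μ ≤ a ^ n * ∫ ω, ∏ k, (C₀ + W k ω) ∂μ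

/-! ## §2 Objects (verbatim conventions of the registered skeleton) -/

section Objects

variable {G : Type} [Group G] [TopologicalSpace G] [IsTopologicalGroup G] [CompactSpace G]
  [MeasurableSpace G] [BorelSpace G]

/-- Edges of `ℤ⁴` interior to the `ℓ^∞`-cube of radius `R` about `x` (both endpoints inside). -/
def cubeEdges (R : ℕ) (x : Zd4) : Set ZdEdge4 :=
  {e | (∀ μ, |e.1 μ - x μ| ≤ R) ∧ ∀ μ, |e.1 μ + (if μ = e.2 then 1 else 0) - x μ| ≤ R}

/-- Their images on the torus of side `L`. -/
def cubeEdgesT (L R : ℕ) (x : Zd4) : Set (Edge 4 L) :=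
  torusEdge L '' cubeEdges R x

/-- The exterior σ-algebra of the cube `Q_R(x)` (cylinder events of the links NOT interior to it). -/
@[reducible] def exterior (L R : ℕ) (x : Zd4) : MeasurableSpace (GaugeConfig 4 L G) :=
  cylinderEvents (X := fun _ : Edge 4 L => G) (cubeEdgesT L R x)ᶜ

/-- The **Markov blanket (shell)** of the cube `Q_R(x)`: links interior to `Q_{R+1}(x)` but not to
`Q_R(x)` (for Wilson's nearest-neighbour plaquette action the conditional law inside `Q_R(x)` given
the exterior reads only these; tree `isSpecification_ymSpecification_t2_holds`). -/
def shellEdgesT (L R : ℕ) (x : Zd4) : Set (Edge 4 L) :=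
  cubeEdgesT L (R + 1) x \ cubeEdgesT L R x

/-- One plaquette `Re tr ρ(U_p)` of orientation `(i, j)` based at `x`, on the torus of side `L`. -/
def torusPlaquette (r : LatticeRep G) (L : ℕ) (i j : Fin 4) (x : Zd4) (U : GaugeConfig 4 L G) : ℝ :=
  plaquetteObs r.ρ x i j (torusLift L U)

/-- The centred plaquette on the symmetric torus of side `2S+1`. -/
def centredPlaquette (r : LatticeRep G) (β : ℝ) (S : ℕ) (x : Zd4) (i j : Fin 4)
    (U : GaugeConfig 4 (2 * S + 1) G) : ℝ :=
  torusPlaquette r (2 * S + 1) i j x U -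
    ∫ V, torusPlaquette r (2 * S + 1) i j x V ∂(wilsonMeasure (d := 4) (L := 2 * S + 1) r.ρ β)

/-- The cube-exterior **conditional mean** `Z_R(x) = E_{β,S}[δp_{ij}(x) | exterior of Q_R(x)]`. -/
def condMean (r : LatticeRep G) (β : ℝ) (S R : ℕ) (x : Zd4) (i j : Fin 4) :
    GaugeConfig 4 (2 * S + 1) G → ℝ :=
  (wilsonMeasure (d := 4) (L := 2 * S + 1) r.ρ β)[centredPlaquette r β S x i j |
    exterior (2 * S + 1) R x]

/-- **Influence profile** `I_p(β, S, R; x, ij) = ‖Z_R(x)‖_{Lᵖ(μ_{β,S})}` (skeleton, verbatim). -/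
def influence (r : LatticeRep G) (β : ℝ) (S R : ℕ) (x : Zd4) (i j : Fin 4) (p : ℝ≥0∞) : ℝ :=
  (eLpNorm (condMean r β S R x i j) p (wilsonMeasure (d := 4) (L := 2 * S + 1) r.ρ β)).toReal

end Objects

/-! ## §3 The two window inputs of the line and its output -/

/-- **(CM) Conditional influence domination by a background functional.**  For every compact
simple `G`, faithful `r`, rate function `m` (`m(β) > 0`, `m(β) → 0`: the imported correlation
length) and window fraction `c₀`, there are a blow-up factor `λ ≥ 1`, constants `C₀, C₁`, and a
family of SHELL FUNCTIONALS `W β S R x ≥ 0` — bounded, measurable, depending only on the Markov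
blanket of the cube `Q_{λR}(x)` — such that, for `β ≥ β₀`, large tori, `1 ≤ R ≤ c₀/m(β)`:
the conditional mean of `|Z_R(x)|` given the EXTERIOR of `Q_{λR}(x)` is a.e. at most
`I₂(R) · (C₀ + C₁ W)`.  (Gaussian proxy: `W` = squared field strength at `x` of the classical
Dirichlet extension of the outer boundary data, in units of its typical value; the bound is the
background-field expansion of the plaquette to second order.  Content only for SMALL backgrounds:
once `C₁ W ≥ 12N / I₂` the bound is trivial.) -/
def ConditionalInfluenceDomination : Prop :=
  ∀ (G : Type) [Group G] [TopologicalSpace G] [IsTopologicalGroup G] [CompactSpace G]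
    [MeasurableSpace G] [BorelSpace G], IsCompactSimpleLieGroup G →
    ∀ (r : LatticeRep G) (β₁ : ℝ) (m : ℝ → ℝ), (∀ β : ℝ, β₁ ≤ β → 0 < m β) →
      Tendsto m atTop (𝓝 0) → ∀ c₀ : ℝ, 0 < c₀ →
      ∃ (lam : ℕ) (C₀ C₁ β₀ B : ℝ)
        (W : ℝ → (S : ℕ) → ℕ → Zd4 → GaugeConfig 4 (2 * S + 1) G → ℝ),
        1 ≤ lam ∧ 0 ≤ C₀ ∧ 0 ≤ C₁ ∧
        (∀ β S R x U, 0 ≤ W β S R x U ∧ W β S R x U ≤ B) ∧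
        (∀ β S R x, Measurable (W β S R x)) ∧
        (∀ β S R x, DependsOn (W β S R x) (shellEdgesT (2 * S + 1) (lam * R) x)) ∧
        ∀ β : ℝ, β₀ ≤ β → ∃ S₀ : ℕ, ∀ S : ℕ, S₀ ≤ S → ∀ R : ℕ, 1 ≤ R → (R : ℝ) ≤ c₀ / m β →
          2 * (lam * R) + 4 < 2 * S + 1 → ∀ (x : Zd4) (i j : Fin 4), i ≠ j →
            let μ := wilsonMeasure (d := 4) (L := 2 * S + 1) r.ρ β
            μ[(fun U => |condMean r β S R x i j U|) | exterior (2 * S + 1) (lam * R) x] ≤ᵐ[μ]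
              fun U => influence r β S R x i j 2 * (C₀ + C₁ * W β S R x U)

/-- **(F) Background product bound** (consumable form of "finite block pressure of `W`"): for the
SAME data as (CM), products of `C₀ + C₁ W` over cubes whose λ-blankets are pairwise disjoint cost at
most `C₂ⁿ`, uniformly in the window and the volume.  Intended proof: Hölder over the `3⁴`
residue classes of the centres' blocks, the chessboard estimate on the symmetric torus in all four
axes (tree `chessboard_le_rpow_even`, `oddCycle_chessboard`; Wilson RP
`wilsonExpectation_oddReflectionPositive` transported by coordinate permutations), and ONE block
quantity: the disseminated exponential moment (pressure per block) of `W`. -/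
def BackgroundProductBound : Prop :=
  ∀ (G : Type) [Group G] [TopologicalSpace G] [IsTopologicalGroup G] [CompactSpace G]
    [MeasurableSpace G] [BorelSpace G] (r : LatticeRep G) (m : ℝ → ℝ) (c₀ : ℝ) (lam : ℕ)
    (C₀ C₁ β₀ : ℝ) (W : ℝ → (S : ℕ) → ℕ → Zd4 → GaugeConfig 4 (2 * S + 1) G → ℝ),
    (∀ β S R x U, 0 ≤ W β S R x U) →
    (∀ β S R x, DependsOn (W β S R x) (shellEdgesT (2 * S + 1) (lam * R) x)) →
      ∃ C₂ β₂ : ℝ, ∀ β : ℝ, max β₀ β₂ ≤ β → ∃ S₀ : ℕ, ∀ S : ℕ, S₀ ≤ S →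
        ∀ (R n : ℕ) (x : Fin n → Zd4), 1 ≤ R → (R : ℝ) ≤ c₀ / m β →
          4 * (lam * R) + 8 < 2 * S + 1 →
          (∀ k l, k ≠ l → ∃ μ : Fin 4,
              (2 * (lam * R) + 3 : ℤ) < |x k μ - x l μ| ∧ |x k μ - x l μ| ≤ S) →
            ∫ U, ∏ k, (C₀ + C₁ * W β S R (x k) U)
                ∂(wilsonMeasure (d := 4) (L := 2 * S + 1) r.ρ β) ≤ C₂ ^ n

/-- **OUTPUT: peeled Gaussian domination** — separated `n`-point functions of centred plaquettes
are at most `(C · I₂(R))ⁿ`: the `(n/2)`-th power of a TWO-point-type quantity with a pure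
geometric constant, no `n^γ`, no `Lⁿ` norms (compare the skeleton's `GaussianDomination`, which
carries `(C n^γ √A)ⁿ` through `InfluenceReverseHolder`). -/
def PeeledGaussianDomination : Prop :=
  ∀ (G : Type) [Group G] [TopologicalSpace G] [IsTopologicalGroup G] [CompactSpace G]
    [MeasurableSpace G] [BorelSpace G], IsCompactSimpleLieGroup G →
    ∀ (r : LatticeRep G) (β₁ : ℝ) (m : ℝ → ℝ), (∀ β : ℝ, β₁ ≤ β → 0 < m β) →
      Tendsto m atTop (𝓝 0) → ∀ c₀ : ℝ, 0 < c₀ →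
      ∃ (lam : ℕ) (C β₀ : ℝ), 1 ≤ lam ∧ ∀ β : ℝ, β₀ ≤ β → ∃ S₀ : ℕ, ∀ S : ℕ, S₀ ≤ S →
        ∀ (R n : ℕ) (o : Fin n → Fin 4 × Fin 4) (x : Fin n → Zd4),
          (∀ k, (o k).1 ≠ (o k).2) → 1 ≤ R → (R : ℝ) ≤ c₀ / m β →
          4 * (lam * R) + 8 < 2 * S + 1 →
          (∀ k l, k ≠ l → ∃ μ : Fin 4,
              (2 * (lam * R) + 3 : ℤ) < |x k μ - x l μ| ∧ |x k μ - x l μ| ≤ S) →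
            let μ := wilsonMeasure (d := 4) (L := 2 * S + 1) r.ρ β
            |∫ U, ∏ k, centredPlaquette r β S (x k) (o k).1 (o k).2 U ∂μ|
              ≤ ∏ k, C * influence r β S R (x k) (o k).1 (o k).2 2

/-! ## §4 Shape of the glue (the proof is (T) + `PeelingBound` + Markov + (CM) + (F)) -/

/-- The glue the crux-plan seat will prove: telescoping (landed) + peeling + (CM) + (F) ⇒ output. -/
def GlueShape : Prop :=
  PeelingBound → ConditionalInfluenceDomination → BackgroundProductBound → PeeledGaussianDomination

end Summit.QuantumFields.YangMills.Cruxes.HypercubicLimit.PeelAndDisseminate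

end
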